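import Summits.AtomisticToContinuum.Crystallization.Theorems.FreeSplittingCertificatesStrictSplittingRuleHcpShellMoments

/-!
# `StrictSplittingRule` (stmt-AtomisticToContinuum-12560): fourth moments of the relaxed hcp first shell

Route `FreeSplittingCertificates`, crux r3 `StrictSplittingRule`, line `registered` (unit b2b-freesplit-B, gen 6).
Companion of `…StrictSplittingRuleHcpShellMoments.lean` (moments up to order three).  The RECEIPTS of an import family at a far
site `x` are `ω(‖y_x‖)·Σ_s ⟪y_s, v_{x_s} − v_x⟫²`; on slowly varying (affine) fields `v_{x_s} − v_x = G y_s` this is the quartic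
shell form `Σ_s ⟪y_s, G y_s⟫²`, i.e. the FOURTH-MOMENT tensor of the shell contracted with the strain — the nearest-neighbour
Cauchy–Born tensor of the relaxed hcp crystal, which is also the continuum symbol of the receipts in the far lemma of the H12⋆
architecture (HOME CERT.md §14–§15) and the even part of the matrix potential of the (hcp-defeated) vector ground-state route
(FAR-LEMMA-SPEC §5 (f)).  This file records its diagonal in closed form:

* `hcpShell_fourth_moment_inLayer` — `Σ_{in-layer} ⟪z, y_s⟫⁴ = (9/4) a⁴ (z₀² + z₁²)²` (the hexagon is 4-isotropic in the layer);
* `hcpShell_fourth_moment_offLayer` — `Σ_{off-layer} ⟪z, y_s⟫⁴ = (1/4) a⁴ (z₀² + z₁²)² + 6 a² h² (z₀² + z₁²) z₂² + 6 h⁴ z₂⁴`;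
* `hcpShell_fourth_moment` — `Σ_s ⟪z, y_s⟫⁴ = (5/2) a⁴ ρ⁴ + 6 a² h² ρ² z₂² + 6 h⁴ z₂⁴`, `ρ² = z₀² + z₁²`
  (ideal ratio `h² = 2a²/3`: `(5/2)ρ⁴ + 4ρ²z₂² + (8/3)z₂⁴` in units of `a⁴` — between `2.29` and `2.67` per `‖z‖⁴`, against `12/5`
  for an isotropic twelve-point design);
* `hcpShell_fourth_moment_ge` — the isotropic lower bound `Σ_s ⟪z, y_s⟫⁴ ≥ min((5/2)a⁴, 6h⁴, 3a²h²)·‖z‖⁴`.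

Structural bookkeeping ([folklore]); VALUE = a kernel-checked brick — NOT summit progress.
-/

noncomputable section

namespace Summit.AtomisticToContinuum.Crystallization.Theorems.StrictSplittingRuleBirth

open scoped BigOperators
open Literature.MathematicalPhysics.StatisticalMechanics
open Summit.AtomisticToContinuum.Crystallization.Theorems.PalmUnimodularRigidity.LayeredLawsSelectHcp

/-- **Fourth moment of the in-layer hexagon**: `Σ ⟪z, y_s⟫⁴ = (9/4) a⁴ (z₀² + z₁²)²`. [folklore] -/
theorem hcpShell_fourth_moment_inLayer (a h : ℝ) (z : EuclideanSpace ℝ (Fin 3)) :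
    inner ℝ z (hcpSite a h (0, 1, 0)) ^ 4 + inner ℝ z (hcpSite a h (0, -1, 0)) ^ 4 +
      inner ℝ z (hcpSite a h (0, 0, 1)) ^ 4 + inner ℝ z (hcpSite a h (0, 0, -1)) ^ 4 +
      inner ℝ z (hcpSite a h (0, 1, -1)) ^ 4 + inner ℝ z (hcpSite a h (0, -1, 1)) ^ 4 =
      9 / 4 * a ^ 4 * (z 0 ^ 2 + z 1 ^ 2) ^ 2 := by
  obtain ⟨e1, e2, e3, e4, e5, e6, -, -, -, -, -, -⟩ := hcpShell_inner a h z
  have h3 : (√3 : ℝ) ^ 2 = 3 := Real.sq_sqrt (by norm_num)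
  have h9 : (√3 : ℝ) ^ 4 = 9 := by rw [show (4 : ℕ) = 2 * 2 by norm_num, pow_mul, h3]; norm_num
  rw [e1, e2, e3, e4, e5, e6]
  linear_combination (3 / 2 * a ^ 4 * z 0 ^ 2 * z 1 ^ 2) * h3 + (1 / 4 * a ^ 4 * z 1 ^ 4) * h9

/-- **Fourth moment of the two off-layer triangles**:
`Σ ⟪z, y_s⟫⁴ = (1/4) a⁴ (z₀² + z₁²)² + 6 a² h² (z₀² + z₁²) z₂² + 6 h⁴ z₂⁴`. [folklore] -/
theorem hcpShell_fourth_moment_offLayer (a h : ℝ) (z : EuclideanSpace ℝ (Fin 3)) :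
    inner ℝ z (hcpSite a h (1, 0, 0)) ^ 4 + inner ℝ z (hcpSite a h (1, -1, 0)) ^ 4 +
      inner ℝ z (hcpSite a h (1, 0, -1)) ^ 4 + inner ℝ z (hcpSite a h (-1, 0, 0)) ^ 4 +
      inner ℝ z (hcpSite a h (-1, -1, 0)) ^ 4 + inner ℝ z (hcpSite a h (-1, 0, -1)) ^ 4 =
      1 / 4 * a ^ 4 * (z 0 ^ 2 + z 1 ^ 2) ^ 2 + 6 * a ^ 2 * h ^ 2 * (z 0 ^ 2 + z 1 ^ 2) * z 2 ^ 2 + 6 * h ^ 4 * z 2 ^ 4 := by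
  obtain ⟨-, -, -, -, -, -, e7, e8, e9, e10, e11, e12⟩ := hcpShell_inner a h z
  have h3 : (√3 : ℝ) ^ 2 = 3 := Real.sq_sqrt (by norm_num)
  have h9 : (√3 : ℝ) ^ 4 = 9 := by rw [show (4 : ℕ) = 2 * 2 by norm_num, pow_mul, h3]; norm_num
  rw [e7, e8, e9, e10, e11, e12]
  ring_nf
  rw [h3, h9]
  ring

/-- **Fourth moment of the shell**: `Σ_s ⟪z, y_s⟫⁴ = (5/2) a⁴ ρ⁴ + 6 a² h² ρ² z₂² + 6 h⁴ z₂⁴`, `ρ² = z₀² + z₁²`. [folklore] -/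
theorem hcpShell_fourth_moment (a h : ℝ) (z : EuclideanSpace ℝ (Fin 3)) :
    ∑ s ∈ hcpStarIdx, inner ℝ z (hcpSite a h s) ^ 4 =
      5 / 2 * a ^ 4 * (z 0 ^ 2 + z 1 ^ 2) ^ 2 + 6 * a ^ 2 * h ^ 2 * (z 0 ^ 2 + z 1 ^ 2) * z 2 ^ 2 + 6 * h ^ 4 * z 2 ^ 4 := by
  have hin := hcpShell_fourth_moment_inLayer a h z
  have hoff := hcpShell_fourth_moment_offLayer a h z
  rw [hcpShell_sum_expand]
  linarith

/-- **Isotropic lower bound**: `Σ_s ⟪z, y_s⟫⁴ ≥ min((5/2)a⁴, 6h⁴, 3a²h²) · ‖z‖⁴`. [folklore] -/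
theorem hcpShell_fourth_moment_ge (a h : ℝ) (z : EuclideanSpace ℝ (Fin 3)) :
    min (min (5 / 2 * a ^ 4) (6 * h ^ 4)) (3 * a ^ 2 * h ^ 2) * (‖z‖ ^ 2) ^ 2 ≤
      ∑ s ∈ hcpStarIdx, inner ℝ z (hcpSite a h s) ^ 4 := by
  rw [hcpShell_fourth_moment, norm_sq_eq_three]
  set m := min (min (5 / 2 * a ^ 4) (6 * h ^ 4)) (3 * a ^ 2 * h ^ 2) with hm
  have h1 : m ≤ 5 / 2 * a ^ 4 := (min_le_left _ _).trans (min_le_left _ _)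
  have h2 : m ≤ 6 * h ^ 4 := (min_le_left _ _).trans (min_le_right _ _)
  have h3 : m ≤ 3 * a ^ 2 * h ^ 2 := min_le_right _ _
  have hP : 0 ≤ z 0 ^ 2 + z 1 ^ 2 := by positivity
  have hW : 0 ≤ z 2 ^ 2 := by positivity
  -- (ρ² + w²)² = ρ⁴ + 2ρ²w² + w⁴, each piece dominated
  have e : m * (z 0 ^ 2 + z 1 ^ 2 + z 2 ^ 2) ^ 2 =
      m * (z 0 ^ 2 + z 1 ^ 2) ^ 2 + 2 * m * ((z 0 ^ 2 + z 1 ^ 2) * z 2 ^ 2) + m * (z 2 ^ 2) ^ 2 := by ring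
  rw [e]
  have i1 := mul_le_mul_of_nonneg_right h1 (pow_nonneg hP 2)
  have i2 := mul_le_mul_of_nonneg_right h3 (mul_nonneg hP hW)
  have i3 := mul_le_mul_of_nonneg_right h2 (pow_nonneg hW 2)
  nlinarith [i1, i2, i3]

end Summit.AtomisticToContinuum.Crystallization.Theorems.StrictSplittingRuleBirth

end
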